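import Literature.NumberTheory.Sieve.HeathBrownCubicSieveComparisonFrontier
import Literature.NumberTheory.Sieve.HeathBrownCubicLemma38Holds
import HarnessLib

/-!
# Heath-Brown's display (2.4) holds (discharge of `HeathBrown2001_sieveComparison`)

Pure-proof leaf (one theorem, no definitions, D-0014) closing the programme recorded in
`HeathBrownCubicSieveComparisonFrontier` for the named fact `HeathBrown2001_sieveComparison` of
`HeathBrownCubicPrimesOutline` — display (2.4) of D. R. Heath-Brown, *Primes represented by `x³ + 2y³`*,
Acta Math. 186 (2001), 1–84 (p. 5, established on p. 21 from (3.15)):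
`π(𝒜) = κπ(ℬ) + O(η²X²(log X)^{−1}(log log X)^{−1/6})`, `η = (log X)^{−c}`, `κ = σ₀η(3X)^{−1}`.

The tree proves (2.4) from Lemma 3.4 (the Buchstab decomposition (3.15), proved) and Lemmas 3.5–3.10
(`HeathBrown2001_sieveComparison_of_lemmas`, `HeathBrownCubicTypeIIProofs`; the bookkeeping of p. 21 in
`HeathBrownCubicSieveDecompositionProofs`). Lemmas 3.5 (§6), 3.6 and 3.7 (§7, from the Type I bounds
Lemmas 3.2–3.3 of §5 and Lemma 7.1), 3.9 (§10) and 3.10 (§§11–13) are theorems of the tree, whence the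
frontier form `HeathBrown2001_sieveComparison_of_lemma_3_8` (`HeathBrownCubicSieveComparisonFrontier`);
and Lemma 3.8 (§§8–9: Lemmas 8.1, 9.1–9.5, with Lemma 9.4 = Mitsui's prime number theorem with
Grössencharakteren for `ℚ(∛2)`, uniform in moduli `q ≤ (log z)^A`, through the zero-free region and
Siegel's theorem for the real ray class characters) is now the theorem `HeathBrown2001_lemma_3_8_holds`
(`HeathBrownCubicLemma38Holds`). As the paper warns (p. 19, p. 55), the constants are ineffective.

A separate leaf rather than an append to `HeathBrownCubicSieveComparisonFrontier`, so that the files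
importing the frontier file keep their import closure.

## References

* D. R. Heath-Brown, *Primes represented by `x³ + 2y³`*, Acta Math. 186 (2001), 1–84: (2.4) (p. 5),
  Lemma 3.4 and (3.15) (p. 14), Lemmas 3.5–3.10 (pp. 14–20), p. 21.
  [cite: HeathBrownActa2001, §2 (2.4) and p. 21]

## Tree search

`lean search 'sieveComparison_holds' --decl` (2026-08-15T17:58Z): no match.
Inputs: `HeathBrown2001_sieveComparison_of_lemma_3_8` (`HeathBrownCubicSieveComparisonFrontier`),
`CubicSieve.HeathBrown2001_lemma_3_8_holds` (`HeathBrownCubicLemma38Holds`).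
-/

namespace Literature.NumberTheory.Sieve.CubicPrimes

/-- **Heath-Brown's (2.4) holds** (p. 5; proved on p. 21 from (3.15) and Lemmas 3.5–3.10):
`π(𝒜) = κπ(ℬ) + O(η²X²(log X)^{−1}(log log X)^{−1/6})` with `η = (log X)^{−c}`, `κ = σ₀η(3X)^{−1}` —
the frontier reduction `HeathBrown2001_sieveComparison_of_lemma_3_8` (Lemma 3.4 and Lemmas 3.5, 3.6, 3.7,
3.9, 3.10 proved in the tree) applied to Lemma 3.8 (`CubicSieve.HeathBrown2001_lemma_3_8_holds`).
[cite: HeathBrownActa2001, §2 (2.4) and p. 21] -/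
theorem HeathBrown2001_sieveComparison_holds : HeathBrown2001_sieveComparison :=
  HeathBrown2001_sieveComparison_of_lemma_3_8 CubicSieve.HeathBrown2001_lemma_3_8_holds

end Literature.NumberTheory.Sieve.CubicPrimes
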